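import Summits.QuantumFields.BalabanUV.T4Continuum.Support.SmoothRefineInterp
import Summits.QuantumFields.BalabanUV.T4Continuum.Support.NE3BlockLineAverage
import Summits.QuantumFields.BalabanUV.T4Continuum.Support.NE3TangentNoGoWords
import HarnessLib

/-!
# T⁴ programme, node NE3 — row E-MLw-(w4)-P, flat route H3: THE COARSE-DATA INTERPOLANT (multilinear interpolation of a coarse
# site function on the blocks; corner values, periodicity, and the Dirichlet-energy bound `C_I = 2^{d−1}`)

NE3 (node U1b) formalisation swarm `b2b-balaban-t4-ne3-formalise-*`, leaf seat `b2b-balaban-t4-ne3-formalise-leaf-01`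
(gen 5), row **H3** of ruling ρ-g21-4 (W4) («interpolant `I` of coarse 0-form data with `I(m)(corner z) = m z`,
`‖dPot(I m)‖² ≤ C_I σ^{d−2}Σ|dm|²`») in the SHAPE fixed by ruling ρ-g22-1 (R4) (the socket of the owner's H5a
`NE3SlicePoincareAssembly.sum_norm_sq_le_of_split_interp_frame`).  Over leaf-10's `SmoothRefineInterp` BY NAME — the
interpolant IS `SmoothRefineInterp.interp M Finset.univ m` (multilinear in every direction); nothing is redefined.

CONTENT ([folklore]; 0 sorry; 0 def), `𝔸` any real normed ring-module (`ℂ`, `Matrix n n ℂ`), `M ≥ 1`: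
§1 **`interp_corner`** — `interp M univ m ((M : ℤ) • z) = m z`; **`interp_add_period`** — `m` `N`-periodic ⇒ `interp M S m`
   `(M·N)`-periodic; `dPot_interp` — `dPot (interp M univ m) y α = (1∕M) • interp M (univ.erase α) (cfd α m) y` (`interp_fd`);
§2 the LOCAL convexity bound **`normSq_interpCore_le`** — `‖interpCore S G z w‖² ≤ Σ_{T ⊆ S} ‖G (z + indic T)‖²` for weights in
   `[0,1]` (induction on `S`; `‖(1−t)A + tB‖² ≤ ‖A‖² + ‖B‖²`), and `normSq_interp_le`;
§3 **`sum_normSq_dPot_interp_le`** — for `N`-periodic `m`,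
   `Σ_{y∈periodBox (M·N)} Σ_α ‖dPot (interp M univ m) y α‖² ≤ 2^(d−1) · ((M:ℝ)^d ∕ (M:ℝ)^2) · Σ_{z∈periodBox N} Σ_α ‖dPot m z α‖²`
   (blocks by `sum_periodBox_blocks`; the `2^{d−1}` vertices of the transverse face; shift-invariance of periodic sums) —
   **`C_I = 2^{d−1}`**, `k`-free, `N`-free.

HONEST FRAMING.  Pure lattice calculus; nothing about Bałaban's minimisers; (P♮), (ML_w) at W ≠ 1, T-E_w and **NE3 are NOT
proved**; spine PROVED 0∕9; finite T⁴ rung (B)+1 — NOT infinite volume, NOT mass gap, NOT `BetaPertH`, NOT Clay.  PLACEMENT: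
`Summits/QuantumFields/BalabanUV/`.  HONEST DEPENDENCY (cell page 1): continuum YM on T⁴ ⇐ BetaPertH ∧ nine spine estimates
(0/9 proved); BetaPertH ⇐ (D1) ∧ (D4) ∧ CAP+tail; G-an2-4 gates asym, D1 and NE2/3/4.
-/

set_option autoImplicit false

open scoped BigOperators
open Finset

namespace Summit.QuantumFields.BalabanUV.T4Continuum.NE3CoarseInterpolant

open Literature.MathematicalPhysics.QuantumFieldTheory.Balaban1983to89
open B7Prop1Explicit
open T4AveragingDeficitWallBoundary (periodBox mem_periodBox card_periodBox sum_periodBox_shift)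
open SmoothRefineBlocks (blk res blk_res_smul blk_res_add_period blk_res_eq_of)
open SmoothRefineInterp (indic indic_insert cfd interpCore interpCore_empty interpCore_insert interpCore_shift wt wt_nonneg
  wt_le_one interp interp_of_res_eq_zero interp_fd dcoef)
open NE3BlockLineAverage (sum_periodBox_blocks)
open NE3TangentNoGoWords (dPot)

noncomputable section

variable {d : ℕ}

/-! ## §1 Corner values, periodicity, and the coboundary of the interpolant -/

section Values

variable {X : Type*} [AddCommGroup X] [Module ℝ X]

/-- **THE INTERPOLANT TAKES THE DATUM'S VALUE AT THE BLOCK CORNERS**: `interp M univ m (M•z) = m z`. [folklore] -/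
theorem interp_corner {M : ℕ} (hM : 1 ≤ M) (S : Finset (Fin d)) (m : Site d → X) (z : Site d) :
    interp M S m ((M : ℤ) • z) = m z := by
  obtain ⟨hb, hr⟩ := blk_res_smul (d := d) hM z
  rw [interp_of_res_eq_zero M S m _ (fun i _ => by rw [hr]; rfl), hb]

/-- **PERIODICITY**: for an `N`-periodic datum the interpolant is `(M·N)`-periodic. [folklore] -/
theorem interp_add_period {M : ℕ} (hM : 1 ≤ M) {N : ℕ} (S : Finset (Fin d)) {m : Site d → X}
    (hm : ∀ (z : Site d) (τ : Fin d), m (z + (N : ℤ) • e τ) = m z) (y : Site d) (τ : Fin d) :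
    interp M S m (y + ((M * N : ℕ) : ℤ) • e τ) = interp M S m y := by
  obtain ⟨hb, hr⟩ := blk_res_add_period (d := d) hM y (N : ℤ) τ
  have hP : ((M * N : ℕ) : ℤ) = (M : ℤ) * (N : ℤ) := by push_cast; ring
  have hw : wt M (y + ((M : ℤ) * (N : ℤ)) • e τ) = wt M y := by
    funext i; simp only [wt, hr]
  unfold interp
  rw [hP, hb, hw, interpCore_shift]
  have hfun : (fun x => m (x + (N : ℤ) • e τ)) = m := funext fun x => hm x τ
  rw [hfun]

end Values

section Cobd

variable {𝔸 : Type*} [NormedRing 𝔸] [NormedSpace ℝ 𝔸]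

/-- **THE COBOUNDARY OF THE INTERPOLANT** is `1∕M` times the interpolant, in the transverse directions, of the datum's coarse
difference: `dPot (interp M univ m) y α = (1∕M) • interp M (univ.erase α) (cfd α m) y`. [folklore] -/
theorem dPot_interp {M : ℕ} (hM : 1 ≤ M) (m : Site d → 𝔸) (y : Site d) (α : Fin d) :
    dPot (interp M Finset.univ m) y α = (1 / (M : ℝ)) • interp M (Finset.univ.erase α) (cfd α m) y := by
  simp only [dPot]
  rw [interp_fd hM Finset.univ α m y, dcoef, if_pos (Finset.mem_univ α)]

end Cobd

/-! ## §2 The local convexity bound -/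

section Convexity

variable {X : Type*} [NormedAddCommGroup X] [NormedSpace ℝ X]

/-- `‖(1 − t)•A + t•B‖² ≤ ‖A‖² + ‖B‖²` for `t ∈ [0,1]`. [folklore] -/
theorem normSq_convex_le {t : ℝ} (ht0 : 0 ≤ t) (ht1 : t ≤ 1) (A B : X) :
    ‖(1 - t) • A + t • B‖ ^ 2 ≤ ‖A‖ ^ 2 + ‖B‖ ^ 2 := by
  have h1 : ‖(1 - t) • A + t • B‖ ≤ (1 - t) * ‖A‖ + t * ‖B‖ := by
    calc ‖(1 - t) • A + t • B‖ ≤ ‖(1 - t) • A‖ + ‖t • B‖ := norm_add_le _ _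
      _ = (1 - t) * ‖A‖ + t * ‖B‖ := by
          rw [norm_smul, norm_smul, Real.norm_of_nonneg ht0, Real.norm_of_nonneg (by linarith)]
  have hA := norm_nonneg A
  have hB := norm_nonneg B
  have h2 : ((1 - t) * ‖A‖ + t * ‖B‖) ^ 2 ≤ (1 - t) * ‖A‖ ^ 2 + t * ‖B‖ ^ 2 := by
    nlinarith [sq_nonneg (‖A‖ - ‖B‖), mul_nonneg ht0 (by linarith : 0 ≤ 1 - t)]
  have h3 : (1 - t) * ‖A‖ ^ 2 + t * ‖B‖ ^ 2 ≤ ‖A‖ ^ 2 + ‖B‖ ^ 2 := by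
    nlinarith [sq_nonneg ‖A‖, sq_nonneg ‖B‖]
  calc ‖(1 - t) • A + t • B‖ ^ 2 ≤ ((1 - t) * ‖A‖ + t * ‖B‖) ^ 2 := by
        exact pow_le_pow_left₀ (norm_nonneg _) h1 2
    _ ≤ _ := h2.trans h3

/-- **LOCAL CONVEXITY**: for weights in `[0,1]`, `‖interpCore S G z w‖² ≤ Σ_{T ⊆ S} ‖G (z + indic T)‖²` — the interpolant is
controlled by the `2^{|S|}` vertex values it actually uses. [folklore] -/
theorem normSq_interpCore_le (S : Finset (Fin d)) {w : Fin d → ℝ} (hw0 : ∀ i, 0 ≤ w i) (hw1 : ∀ i, w i ≤ 1) :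
    ∀ (G : Site d → X) (z : Site d), ‖interpCore S G z w‖ ^ 2 ≤ ∑ T ∈ S.powerset, ‖G (z + indic T)‖ ^ 2 := by
  induction S using Finset.induction_on with
  | empty => intro G z; simp
  | insert i S hi ih =>
    intro G z
    rw [interpCore_insert hi, Finset.sum_powerset_insert hi]
    refine (normSq_convex_le (hw0 i) (hw1 i) _ _).trans (add_le_add (ih G z) ?_)
    have h := ih (fun x => G (x + e i)) z
    refine h.trans (le_of_eq (Finset.sum_congr rfl fun T hT => ?_))
    have hiT : i ∉ T := fun h' => hi (Finset.mem_powerset.1 hT h')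
    rw [indic_insert hiT, ← add_assoc, add_right_comm z (indic T) (e i)]

/-- The local convexity bound on the fine lattice: `‖interp M S G y‖² ≤ Σ_{T ⊆ S} ‖G (blk M y + indic T)‖²`. [folklore] -/
theorem normSq_interp_le {M : ℕ} (hM : 1 ≤ M) (S : Finset (Fin d)) (G : Site d → X) (y : Site d) :
    ‖interp M S G y‖ ^ 2 ≤ ∑ T ∈ S.powerset, ‖G (blk M y + indic T)‖ ^ 2 :=
  normSq_interpCore_le S (wt_nonneg hM y) (wt_le_one hM y) G _

end Convexity

/-! ## §3 The Dirichlet-energy bound -/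

section Energy

variable {𝔸 : Type*} [NormedRing 𝔸] [NormedSpace ℝ 𝔸]

/-- The block of `M•z + v`, `v ∈ [0,M)^d`, is `z`. [folklore] -/
theorem blk_block {M : ℕ} (hM : 1 ≤ M) (z : Site d) {v : Site d} (hv : v ∈ periodBox (d := d) M) :
    blk M ((M : ℤ) • z + v) = z :=
  (blk_res_eq_of hM rfl (fun i => ((mem_periodBox).1 hv i).1) (fun i => ((mem_periodBox).1 hv i).2)).1

/-- **THE DIRICHLET ENERGY OF THE INTERPOLANT** (`C_I = 2^{d−1}`): `M, N ≥ 1`, `m` `N`-periodic ⇒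
`Σ_{y∈periodBox (M·N)} Σ_α ‖dPot (interp M univ m) y α‖² ≤ 2^(d−1) · (M^d ∕ M²) · Σ_{z∈periodBox N} Σ_α ‖dPot m z α‖²`. [folklore] -/
theorem sum_normSq_dPot_interp_le {M N : ℕ} (hM : 1 ≤ M) (hN : 1 ≤ N) {m : Site d → 𝔸}
    (hm : ∀ (z : Site d) (τ : Fin d), m (z + (N : ℤ) • e τ) = m z) :
    ∑ y ∈ periodBox (d := d) (M * N), ∑ α : Fin d, ‖dPot (interp M Finset.univ m) y α‖ ^ 2
      ≤ (2 : ℝ) ^ (d - 1) * ((M : ℝ) ^ d / (M : ℝ) ^ 2)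
          * ∑ z ∈ periodBox (d := d) N, ∑ α : Fin d, ‖dPot m z α‖ ^ 2 := by
  have hM0 : (0 : ℝ) < M := by exact_mod_cast (by omega : 0 < M)
  -- pointwise: the coboundary is `(1/M)•` a transverse interpolant of the coarse difference, then local convexity
  have hpt : ∀ (y : Site d) (α : Fin d), ‖dPot (interp M Finset.univ m) y α‖ ^ 2
      ≤ (1 / (M : ℝ) ^ 2) * ∑ T ∈ (Finset.univ.erase α).powerset, ‖dPot m (blk M y + indic T) α‖ ^ 2 := by
    intro y α
    rw [dPot_interp hM m y α, norm_smul, mul_pow, Real.norm_of_nonneg (by positivity), one_div, inv_pow, ← one_div]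
    refine mul_le_mul_of_nonneg_left ?_ (by positivity)
    exact normSq_interp_le hM _ (cfd α m) y
  -- sum over the torus block by block: the block of `M•z + v` is `z`, so each block contributes `M^d` equal terms
  have hblocks : ∑ y ∈ periodBox (d := d) (M * N), ∑ α : Fin d,
      (1 / (M : ℝ) ^ 2) * ∑ T ∈ (Finset.univ.erase α).powerset, ‖dPot m (blk M y + indic T) α‖ ^ 2
      = (M : ℝ) ^ d * ∑ z ∈ periodBox (d := d) N, ∑ α : Fin d,
          (1 / (M : ℝ) ^ 2) * ∑ T ∈ (Finset.univ.erase α).powerset, ‖dPot m (z + indic T) α‖ ^ 2 := by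
    rw [← sum_periodBox_blocks M N hM, Finset.mul_sum]
    refine Finset.sum_congr rfl fun z _ => ?_
    rw [Finset.sum_congr rfl fun v hv => by rw [blk_block hM z hv], Finset.sum_const, card_periodBox, nsmul_eq_mul,
      Nat.cast_pow]
  -- each vertex shift is a periodic shift of the `z`-sum
  have hshift : ∀ (α : Fin d) (T : Finset (Fin d)),
      ∑ z ∈ periodBox (d := d) N, ‖dPot m (z + indic T) α‖ ^ 2 = ∑ z ∈ periodBox (d := d) N, ‖dPot m z α‖ ^ 2 := by
    intro α T
    refine sum_periodBox_shift N hN (g := fun z => ‖dPot m z α‖ ^ 2) (fun x κ => ?_) (indic T)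
    simp only [dPot]
    rw [add_right_comm, hm, hm]
  have hcard : ∀ α : Fin d, (((Finset.univ : Finset (Fin d)).erase α).powerset.card : ℝ) = (2 : ℝ) ^ (d - 1) := by
    intro α
    rw [Finset.card_powerset, Finset.card_erase_of_mem (Finset.mem_univ α), Finset.card_univ, Fintype.card_fin]
    push_cast; ring
  have hinner : ∀ α : Fin d, ∑ z ∈ periodBox (d := d) N,
      (1 / (M : ℝ) ^ 2) * ∑ T ∈ (Finset.univ.erase α).powerset, ‖dPot m (z + indic T) α‖ ^ 2
      = (1 / (M : ℝ) ^ 2) * ((2 : ℝ) ^ (d - 1) * ∑ z ∈ periodBox (d := d) N, ‖dPot m z α‖ ^ 2) := by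
    intro α
    rw [← Finset.mul_sum, Finset.sum_comm, Finset.sum_congr rfl fun T _ => hshift α T, Finset.sum_const, nsmul_eq_mul,
      hcard]
  calc ∑ y ∈ periodBox (d := d) (M * N), ∑ α : Fin d, ‖dPot (interp M Finset.univ m) y α‖ ^ 2
      ≤ ∑ y ∈ periodBox (d := d) (M * N), ∑ α : Fin d,
          (1 / (M : ℝ) ^ 2) * ∑ T ∈ (Finset.univ.erase α).powerset, ‖dPot m (blk M y + indic T) α‖ ^ 2 :=
        Finset.sum_le_sum fun y _ => Finset.sum_le_sum fun α _ => hpt y α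
    _ = (M : ℝ) ^ d * ∑ z ∈ periodBox (d := d) N, ∑ α : Fin d,
          (1 / (M : ℝ) ^ 2) * ∑ T ∈ (Finset.univ.erase α).powerset, ‖dPot m (z + indic T) α‖ ^ 2 := hblocks
    _ = (M : ℝ) ^ d * ∑ α : Fin d, (1 / (M : ℝ) ^ 2) * ((2 : ℝ) ^ (d - 1) * ∑ z ∈ periodBox (d := d) N, ‖dPot m z α‖ ^ 2) := by
        rw [Finset.sum_comm, Finset.sum_congr rfl fun α _ => hinner α]
    _ = (2 : ℝ) ^ (d - 1) * ((M : ℝ) ^ d / (M : ℝ) ^ 2) * ∑ z ∈ periodBox (d := d) N, ∑ α : Fin d, ‖dPot m z α‖ ^ 2 := by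
        rw [← Finset.mul_sum, ← Finset.mul_sum, Finset.sum_comm]
        ring

end Energy

end

end Summit.QuantumFields.BalabanUV.T4Continuum.NE3CoarseInterpolant
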